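import Literature.MathematicalPhysics.QuantumFieldTheory.Balaban1983to89.B15Prop1NumericsThresholds
import Summits.QuantumFields.YangMills.Theorems.BalabanUVNodesN12Prop1OfGaugeLetterAndChartConstantsLoc

/-!
# BalabanUVNodes ∕ N12 — PROPOSITION 1 [IV] AT PRINT'S (1.74) OBJECT, ASSEMBLED AND LOCALISED: the lane owner's ASSEMBLY ORDER (1)–(5) AS ONE THEOREM on the (R-a) socket —
# from the R-explicit (J0′) letter at a reference guard, the LOCALISED gauge letter (σ)_N AT A TARGET TOLERANCE (∀δ∃e form), dag-n12-w4's chart constants with the LOCALISED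
# chart body, the [15] Theorem-1 letter and the instance geometry; the numerics, the guard, the Schur size, the positivity constant and the bookkeeping constants CHOSEN INSIDE

Cell `pub-ymgap` (HUMAN RULINGS D-0062 ∕ D-0149 ∕ D-0154), WIDTH SEAT `pub-ymgap-dag-n12-w5` g5 (node N12 = [B15]; key K1⁹ `stmt-QuantumFields-27364`, `--kind proof --supports …
--as helper`; count-neutral).  CLAIM-2 of this seat MERGED with the lane owner dag-n12-c g19's INTENT-2 `…N12Prop1OfGaugeModuli` by his DEDUP RULING (pub-ymgap INBOX
2026-08-28T13:00:30Z: «the same theorem; merged into w5's stem on one condition: typed ON (o5d)_N, not on p631882»; template `…N12Prop1OfGaugeModuli.HELD.lean` acknowledged).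
THEOREMS ONLY (0 `def`, 0 `instance`, 0 `sorry`); composition BY NAME of this seat's (iii) `N12Prop1OfGaugeLetterAndChartConstantsLoc.…_ofGaugeLetterN_ofChartConstantsN_ofCoercive`
and dag-n12-c g19's numerics file `B15Prop1NumericsThresholds` (p633310: `exists_delta_hsm_chartConstants_family`, `hγle_family_one`, `gamma_one_pos`, `toNat_side_le_succ`,
`plaqSmallOn_of_le`).

WHY.  After (iii) the N12∕s1 Proposition-1 row displays, per instance, besides its LETTERS ((J0′) R-explicit `hMin`, the localised gauge letter (σ)_N, the chart constants with the
localised chart body `hchartN`, the [15] Theorem-1 letter `h15T`, the geometry) a tail of NUMERICS and BOOKKEEPING binders: the guard `eR i`, the datum tolerances `ρn i`, the Schur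
sizes `K i`, the positivity constant `γ`, the tolerances `δc i`∕`δin i` with `hsmall`, the smallness letter `hsm`, `hγle`, and the constants `cE cA cJ` with `hcE hcA hcJ' heRa` —
binders that dag-n12-c g19's ASSEMBLY ORDER (pub-ymgap INBOX 2026-08-28T12:02:30Z, steps (1)–(5)) and discharge recipe (12:24:41Z) tell the K1 knit how to choose.  THIS FILE
runs that recipe ONCE, inside a proof, for a FINITE instance family: (2) (J0′) read at a REFERENCE guard `eR₀ i` serves every smaller guard (`plaqSmallOn_of_le`); (3) `K i := n i
+ 1`, `Kc i := 12𝓐₀ i∕R i·√N₁`, thresholds `δ₀ i` by `exists_delta_hsm_chartConstants_family`, target tolerance `δ⋆ i := min (δ₀ i) (ρs i)`; (4) the localised gauge letter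
(σ)_N, asked in the ∀δ∃e FORM («for every target tolerance a guard» — dag-n12-w6 g2's `exists_gaugeLetterLoc_of_target_atRecord_box` per instance), is called at `δ⋆ i` and
returns a guard `e i`; the guard of the row is `eR i := min (eR₀ i) (e i) (a₁′∕(cE+1)) (ε_reg∕((B₃+1)(cE+1)))`, the datum tolerance `ρn i := ρlin_i·eR i` (`hρn` an equality),
`cE`∕`cJ` by `Finite.exists_le`, `cA` its defining expression, `heRa` by arithmetic; (5) `γ := (12d)²∕(10bx²)` with `hγle` from `hγle_family_one`.  Step (1) — the chart
constants by `choose` from dag-n12-w4's `chartLetter_of_letters_N` — waits for that theorem (LOCATED-CIN ASK-2); until then the constants and the localised chart body are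
BINDERS (as in (iii)).  What the K1 knit supplies for N12's Prop-1 row after this file: (J0′) R-explicit at a reference guard, (σ)_N at a target tolerance (with `N i` and the
producers' geometry letters), the chart constants + body, `h15T`, geometry — nothing numeric.

HONEST FRAMING.  ∃-bookkeeping and real arithmetic over landed theorems; (σ)_N (dag-n12-w6's tower-axial gauge + the interior estimate [15] (16)–(18)), (J0′), the chart body,
the [15] Theorem-1 letter and the geometry stay DISPLAYED; nothing of Bałaban's is asserted; count-neutral; N12 NOT discharged; K1⁹ NOT closed; counts unmoved; one finite 𝕋⁴
programme at fixed `ε = L^{-K}` — R4 closes only the conditional rung `BalabanLadder.UV`; no summit statement is proved here and NOT the Yang–Mills mass gap (Clay); nothing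
continuum ∕ ℝ⁴ ∕ OS.

References: [Balaban1989LargeFieldI] CMP 122 (1989) 175–202, (1.74) p.192, Prop. 1 (1.77)–(1.78) p.194 («for ε > 0 sufficiently small»), (1.79) p.195; [Balaban1989LargeFieldII]
CMP 122 (1989) 355–392, p.357, (1.7)–(1.9) p.358, (1.12)–(1.13) p.359; [Balaban1985Variational] CMP 102 (1985) 277–309, (3)–(4) p.278, Thm 1 (8) p.279, (16)–(18) p.280, Prop. 9
(190) p.309; [Balaban1988Convergent] CMP 119 (1988) 243–285, (2.2) p.255, (2.11)–(2.14) pp.256–257.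
-/

noncomputable section

open Set Finset Metric Filter
open scoped BigOperators Matrix RealInnerProductSpace Real InnerProductSpace Topology Matrix.Norms.L2Operator

namespace Summit.QuantumFields.YangMills.BalabanUVNodes.N12Prop1AssembledOfGaugeLetterAtToleranceLoc

open Literature.MathematicalPhysics.QuantumFieldTheory.Balaban1983to89
open T4Continuum B15DeterminingSets GaugeField B16Sect1Backgrounds B15Prop1Carrier B8Eq17ClassAkV1 BlockAveraging
open B15Prop1SliceTaylorCalculus
open B15Prop1ChartCalculusSU2 (E3)
open T4CubeChartGnomonic (SU2)
open B15Prop1ChartSU2 (su2Chart)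
open B15Prop1SliceCoordinates (GaugeSlice ιA freeBonds)
open B15Prop1AnalyticExtClause (cplxVec anExt)
open T4AdjointCovarianceUnitary (lieSU)
open T4AxialGaugeSmallField (castSite boxPlaqs boxBonds)
open B6BondElimination (unitVec)
open B6TreeGaugePoincare (curl)
open B16Eq18Proof (box mem_box)
open B15Extension193 (extend)
open B15ShellGauge193 (shellGauge)
open B14.Eq213MaximalDomains (side)
open B14.Eq213DetSet B14.Eq216Concrete B15Sect1Instances B15Eq177GaugeInvariance B15Eq177ValueInvariance B15Eq177ValueInvarianceCoDiv B16Sect1Wilson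
open B14.Eq22Determines (blockIter IsBlockUnion)
open Literature.MathematicalPhysics.QuantumFieldTheory.BalabanImbrieJaffe1984to88.BIJ85Eq453GaugeField
open Node00 (expChart msChart constrCard)
open B15Prop1NumericsThresholds (toNat_side_le_succ hγle_family_one gamma_one_pos exists_delta_hsm_chartConstants_family plaqSmallOn_of_le)

variable {F : T4Family}

/-- ★★★ **PROPOSITION 1 [IV] AT PRINT'S (1.74) OBJECT — COERCIVE ROAD, ASSEMBLED AND LOCALISED — FROM THE R-EXPLICIT (J0′) LETTER AT A REFERENCE GUARD, THE LOCALISED GAUGE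
LETTER (σ)_N AT A TARGET TOLERANCE, dag-n12-w4's CHART CONSTANTS WITH THE LOCALISED CHART BODY, THE [15] THEOREM-1 LETTER AND THE INSTANCE GEOMETRY — FOR A FINITE INSTANCE
FAMILY, WITH THE NUMERICS CHOSEN INSIDE.**  This seat's (iii) `N12Prop1OfGaugeLetterAndChartConstantsLoc.…_ofGaugeLetterN_ofChartConstantsN_ofCoercive` with dag-n12-c g19's
assembly order (2)–(5) EXECUTED in the proof: the binders `eR heR ρn hρn K hK1 hKn γ hγ hcJ hγle hsm δc δin hδc0 hδin0 hsmall cJ hcJ' cE hcE0 hcE cA hcA heRa` are GONE;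
NEW binders: `[Finite ι]`, the reference guard `eR₀ i > 0` at which (J0′) is read, `0 < ρs i`, the localised gauge letter in the ∀δ∃e form, the signs `0 < bx`, `0 < a₁′`,
`0 < ν.εreg`.  Conclusion: (iii)'s with `γ := (12d)²∕(10bx²)` explicit.  Proof: the module docstring's steps (2)–(5), then (iii).
[cite: Balaban1989LargeFieldI, (1.74) p.192, Prop. 1 (1.77)–(1.78) p.194 (incl. «for ε > 0 sufficiently small» and the last clause), (1.79) p.195; Balaban1989LargeFieldII, p.357,
(1.7)–(1.9) p.358, (1.12)–(1.13) p.359; Balaban1985Variational, (3)–(4) p.278, Thm 1 (8) p.279, (16)–(18) p.280, Prop. 9 (190) p.309; Balaban1988Convergent, (2.2) p.255, (2.12)–(2.14) pp.256–257] -/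
theorem exists_domain_prop1Printed_lfVarOn_std_su2_box_intrinsic_analytic_atZSeqCoPRecord_ofThm1TorusClass_ofMinimiserFamily_ofGaugeLetterNAtTolerance_ofChartConstantsN_ofCoercive
    (ν : Node00.Stage7Numerics) (Kt : ℕ) (hd3 : 3 ≤ (F.P Kt).d) (h0 : 0 < (F.P Kt).d) {ι : Type} [Finite ι]
    (Z Λ : ι → Set (Site (F.P Kt) 0)) (k : ι → ℕ) (M : ι → ℝ) (hk0 : ∀ i, 0 < k i) (hk : ∀ i, k i ≤ (F.P Kt).m + (F.P Kt).K)
    -- the REFERENCE guard per instance (the guard of the row is chosen below it, inside)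
    (eR₀ : ι → ℝ) (heR₀ : ∀ i, 0 < eR₀ i)
    (T : ∀ i, Finset (PBond (F.P Kt) (k i)))
    (lo hi : ι → Fin (F.P Kt).d → ℤ) (n : ι → ℕ) (hn : ∀ i κ, hi i κ ≤ lo i κ + n i) (hN : ∀ i, n i + 2 < (F.P Kt).sitesPerDir (k i))
    (hbox : ∀ i, pts (k i) (Λ i) = (castSite '' Set.Icc (lo i) (hi i) : Set (Site (F.P Kt) (k i))))
    (hZ : ∀ i, (boxPlaqs (lo i - 1) (hi i + 1) : Set (Plaq (F.P Kt) (k i))) ⊆ plaqsInside (pts (k i) (Z i)))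
    (hTG0 : ∀ i, T i = (box (fun κ => (hi i κ - lo i κ + 1).toNat) (lo i)).image fun x =>
      (⟨castSite (x - unitVec ⟨0, h0⟩), ⟨0, h0⟩⟩ : PBond (F.P Kt) (k i)))
    (hN5 : ∀ i κ, ((hi i κ - lo i κ + 1).toNat : ℤ) + 5 < (F.P Kt).sitesPerDir (k i))
    (ext : ∀ i, GaugeField (F.P Kt) (k i) SU2 → GaugeField (F.P Kt) (k i) SU2)
    (hext : ∀ i Vk, ext i Vk = extend (pts (k i) (Λ i)) (shellGauge Vk (lo i) (hi i)) Vk)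
    (hlohi : ∀ i, lo i ≤ hi i)
    -- the REGION parallelepipeds of the normalisation (the datum tolerances `ρn i` are chosen inside, linear in the guard)
    (LO HI : ι → Fin (F.P Kt).d → ℤ) (hLO : ∀ i, LO i ≤ lo i - 1) (hHI : ∀ i, hi i + 1 ≤ HI i) (n' : ι → ℕ) (hn' : ∀ i κ, HI i κ ≤ LO i κ + n' i)
    (hn'N : ∀ i, n' i < (F.P Kt).sitesPerDir (k i)) (hR' : ∀ i, (boxPlaqs (LO i) (HI i) : Set (Plaq (F.P Kt) (k i))) ⊆ plaqsInside (pts (k i) (Z i)))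
    {bx : ℝ} (hbx : 0 < bx)
    (hbxM : ∀ i, 12 * ((F.P Kt).d : ℝ) * ((n i : ℝ) + 2) ^ 2 ≤ bx * (M i) ^ 2)
    {R 𝓐₀ : ι → ℝ} (hM : ∀ i, 1 ≤ (M i)) (hR : ∀ i, 0 < R i)
    -- (J0′), R-EXPLICIT, AT THE REFERENCE GUARD: per instance one radius and one bound for every base field of the strict guard `eR₀ i`
    (hMin : ∀ i Vk, PlaqSmallOn (plaqsInside (pts (k i) (Z i ∩ (Λ i)ᶜ))) (eR₀ i) Vk →
      ∃ Ũ : VecField (F.P Kt) (k i) (EuclideanSpace ℂ (Fin 3)) × VecField (F.P Kt) (k i) (EuclideanSpace ℂ (Fin 3)) →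
          PBond (F.P Kt) 0 → Matrix (Fin 2) (Fin 2) ℂ,
        (∀ b a c, DifferentiableOn ℂ (fun z => Ũ z b a c) (ball 0 (R i))) ∧
        (∀ z ∈ ball (0 : VecField (F.P Kt) (k i) (EuclideanSpace ℂ (Fin 3)) × VecField (F.P Kt) (k i) (EuclideanSpace ℂ (Fin 3))) (R i),
          ∀ b a c, ‖Ũ z b a c‖ ≤ 𝓐₀ i) ∧
        ∀ p B' : VecField (F.P Kt) (k i) E3, ‖p‖ < R i → ‖B'‖ < R i → ∃ U' : GaugeField (F.P Kt) 0 SU2,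
          (∀ b, Ũ (cplxVec p, cplxVec B') b = ((U' b : SU2) : Matrix (Fin 2) (Fin 2) ℂ)) ∧
            IsMinimizer (Node00.avOfRecord F 2 Kt) (Node00.regMSCoPOfRecord F 2 ν Kt (k i) (maxDomT ν.M₁ (Z i))) (Bj ν.M₁ (Z i) (k i))
              (avgFamily (Node00.avOfRecord F 2 Kt) (qsstarGIter0 (k i) (expMul su2Chart B' (ext i (expMul su2Chart p Vk))))) U')
    -- dag-n12-w4's CHART CONSTANTS (binders, with the localised chart body below, until `chartLetter_of_letters_N` lands) and the (J0′) bound's sign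
    (ρs Cμ Cρ C₂ Cτ : ι → ℝ) (hρs : ∀ i, 0 < ρs i) (hCμ : ∀ i, 0 ≤ Cμ i) (hCρ : ∀ i, 0 ≤ Cρ i) (hC₂ : ∀ i, 0 ≤ C₂ i) (h𝓐₀ : ∀ i, 0 ≤ 𝓐₀ i)
    -- LOCATED-CIN (R-a): per instance the bond neighbourhood on which the `inputs` near-flatness is delivered ∕ asked
    (N : ι → Set (PBond (F.P Kt) 0))
    -- (σ)_N THE LOCALISED GAUGE LETTER per instance, IN THE ∀δ∃e FORM (dag-n12-c g19 2026-08-28T12:02:30Z ∕ 13:00:30Z; dag-n12-w6 g2's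
    -- `B15Prop1GaugeLetterGammaZeroPin.exists_gaugeLetterLoc_of_target_atRecord_box` per instance): for every target tolerance `δ > 0` a guard `e > 0` such that at every base
    -- field of the guard `e` whose extended datum is within `ρlin_i·e` of `1` on the region box, every (2.12) minimiser has a residual gauge with the root letter, `σ • U₀`
    -- `δ`-near `1` on the `Ω₁(Z_i)`-plaquette bonds and on `inputs 𝐁_k(Z_i) ∩ N i` (`ρlin_i` = the `hρn` coefficient of p631882, spelled)
    (hσN : ∀ i (δ : ℝ), 0 < δ → ∃ e : ℝ, 0 < e ∧ ∀ (Vk : GaugeField (F.P Kt) (k i) SU2), PlaqSmallOn (plaqsInside (pts (k i) (Z i ∩ (Λ i)ᶜ))) e Vk →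
      (∀ b ∈ (boxBonds (LO i) (HI i) : Set (PBond (F.P Kt) (k i))), dist1 (ext i Vk b) ≤
        (((F.P Kt).d : ℝ) * n' i + 1) * ((((F.P Kt).d - 1 : ℕ) : ℝ) * n' i * ((12 * (F.P Kt).d * (n i + 2) ^ 2 + 1) * e) + 3 * (F.P Kt).d * (n i + 2) ^ 2 * e)) →
      ∀ U₀ : GaugeField (F.P Kt) 0 SU2,
        IsMinimizer (Node00.avOfRecord F 2 Kt) (Node00.regMSCoPOfRecord F 2 ν Kt (k i) (maxDomT ν.M₁ (Z i))) (Bj ν.M₁ (Z i) (k i))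
          (avgFamily (Node00.avOfRecord F 2 Kt) (qsstarGIter0 (k i) (ext i Vk))) U₀ →
        ∃ σ : GaugeTransf (F.P Kt) 0 SU2,
          (∀ j, j ≤ k i → ∀ b ∈ bondsOf (Bj ν.M₁ (Z i) (k i) j), toMS σ j b.src = 1 ∧ toMS σ j b.tgt = 1) ∧
            (∀ p : Plaq (F.P Kt) 0, ((⟨p.src, p.μ⟩ : PBond (F.P Kt) 0) ∈ {b : PBond (F.P Kt) 0 | b.src ∈ maxDomT ν.M₁ (Z i) 1} ∨
                (⟨p.src.shift p.μ, p.ν⟩ : PBond (F.P Kt) 0) ∈ {b : PBond (F.P Kt) 0 | b.src ∈ maxDomT ν.M₁ (Z i) 1} ∨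
                (⟨p.src.shift p.ν, p.μ⟩ : PBond (F.P Kt) 0) ∈ {b : PBond (F.P Kt) 0 | b.src ∈ maxDomT ν.M₁ (Z i) 1} ∨
                (⟨p.src, p.ν⟩ : PBond (F.P Kt) 0) ∈ {b : PBond (F.P Kt) 0 | b.src ∈ maxDomT ν.M₁ (Z i) 1}) →
              ‖((gaugeAct σ U₀ ⟨p.src, p.μ⟩ : SU2) : Matrix (Fin 2) (Fin 2) ℂ) - 1‖ ≤ δ ∧ ‖((gaugeAct σ U₀ ⟨p.src.shift p.μ, p.ν⟩ : SU2) : Matrix (Fin 2) (Fin 2) ℂ) - 1‖ ≤ δ ∧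
                ‖((gaugeAct σ U₀ ⟨p.src.shift p.ν, p.μ⟩ : SU2) : Matrix (Fin 2) (Fin 2) ℂ) - 1‖ ≤ δ ∧ ‖((gaugeAct σ U₀ ⟨p.src, p.ν⟩ : SU2) : Matrix (Fin 2) (Fin 2) ℂ) - 1‖ ≤ δ) ∧
          (∀ b ∈ inputs (Bj ν.M₁ (Z i) (k i)), b ∈ N i → ‖((gaugeAct σ U₀ b : SU2) : Matrix (Fin 2) (Fin 2) ℂ) - 1‖ ≤ δ))
    -- (χ)_N AT THE CHART CONSTANTS: the body of dag-n12-w4's `chartLetter_of_letters` after its `∃ ρs Cμ Cρ C₂ Cτ`, per instance, with its `inputs` PREMISE LOCALISED to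
    -- `N i` — a BINDER until `chartLetter_of_letters_N` lands
    (hchartN : ∀ i,
      ∀ (ext' : GaugeField (F.P Kt) (k i) SU2 → GaugeField (F.P Kt) (k i) SU2) (Vk : GaugeField (F.P Kt) (k i) SU2) {R' A' : ℝ}, 0 < R' → 0 ≤ A' →
      ∀ {δ' δi' : ℝ}, 0 ≤ δ' → 0 ≤ δi' → 0 < max δ' δi' → max δ' δi' ≤ ρs i →
      ∀ (U₀ : GaugeField (F.P Kt) 0 SU2) (Xf : GaugeSlice (pts (k i) (Λ i)) (T i) E3 → PBond (F.P Kt) 0 → lieSU (Fin 2)),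
      IsMinimizer (Node00.avOfRecord F 2 Kt) (Node00.regMSCoPOfRecord F 2 ν Kt (k i) (maxDomT ν.M₁ (Z i))) (Bj ν.M₁ (Z i) (k i))
        (avgFamily (Node00.avOfRecord F 2 Kt) (qsstarGIter0 (k i) (ext' Vk))) U₀ →
      (∀ p : Plaq (F.P Kt) 0, ((⟨p.src, p.μ⟩ : PBond (F.P Kt) 0) ∈ {b : PBond (F.P Kt) 0 | b.src ∈ maxDomT ν.M₁ (Z i) 1} ∨
          (⟨p.src.shift p.μ, p.ν⟩ : PBond (F.P Kt) 0) ∈ {b : PBond (F.P Kt) 0 | b.src ∈ maxDomT ν.M₁ (Z i) 1} ∨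
          (⟨p.src.shift p.ν, p.μ⟩ : PBond (F.P Kt) 0) ∈ {b : PBond (F.P Kt) 0 | b.src ∈ maxDomT ν.M₁ (Z i) 1} ∨
          (⟨p.src, p.ν⟩ : PBond (F.P Kt) 0) ∈ {b : PBond (F.P Kt) 0 | b.src ∈ maxDomT ν.M₁ (Z i) 1}) →
        ‖((U₀ ⟨p.src, p.μ⟩ : SU2) : Matrix (Fin 2) (Fin 2) ℂ) - 1‖ ≤ δ' ∧ ‖((U₀ ⟨p.src.shift p.μ, p.ν⟩ : SU2) : Matrix (Fin 2) (Fin 2) ℂ) - 1‖ ≤ δ' ∧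
          ‖((U₀ ⟨p.src.shift p.ν, p.μ⟩ : SU2) : Matrix (Fin 2) (Fin 2) ℂ) - 1‖ ≤ δ' ∧ ‖((U₀ ⟨p.src, p.ν⟩ : SU2) : Matrix (Fin 2) (Fin 2) ℂ) - 1‖ ≤ δ') →
      (∀ b ∈ inputs (Bj ν.M₁ (Z i) (k i)), b ∈ N i → ‖((U₀ b : SU2) : Matrix (Fin 2) (Fin 2) ℂ) - 1‖ ≤ δi') →
      Xf 0 = 0 → ContDiffAt ℝ 2 Xf 0 →
      (∀ᶠ Y in 𝓝 (0 : GaugeSlice (pts (k i) (Λ i)) (T i) E3),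
        IsMinimizer (Node00.avOfRecord F 2 Kt) (Node00.regMSCoPOfRecord F 2 ν Kt (k i) (maxDomT ν.M₁ (Z i))) (Bj ν.M₁ (Z i) (k i))
          (avgFamily (Node00.avOfRecord F 2 Kt) (qsstarGIter0 (k i) (expMul su2Chart (ιA (pts (k i) (Λ i)) (T i) Y) (ext' Vk)))) (expChart U₀ (Xf Y))) →
      (∀ (X : GaugeSlice (pts (k i) (Λ i)) (T i) E3) (b : PBond (F.P Kt) 0),
        ‖((fderiv ℝ Xf 0 X b : lieSU (Fin 2)) : Matrix (Fin 2) (Fin 2) ℂ)‖ ≤ 8 * A' / R' * ‖X‖ ∧ ‖fderiv ℝ Xf 0 X b‖ ≤ 12 * A' / R' * ‖X‖) →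
      (∀ (X : GaugeSlice (pts (k i) (Λ i)) (T i) E3) (b : PBond (F.P Kt) 0), b.src ∉ maxDomT ν.M₁ (Z i) 1 → fderiv ℝ Xf 0 X b = 0) →
      ∃ (Ψ₂ : (PBond (F.P Kt) 0 → lieSU (Fin 2)) →L[ℝ] (PBond (F.P Kt) 0 → lieSU (Fin 2)) →L[ℝ] (Fin (constrCard (Bj ν.M₁ (Z i) (k i)) (k i)) → lieSU (Fin 2)))
        (lam : (Fin (constrCard (Bj ν.M₁ (Z i) (k i)) (k i)) → lieSU (Fin 2)) →L[ℝ] ℝ)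
        (p : Seminorm ℝ (PBond (F.P Kt) 0 → lieSU (Fin 2))) (q : (Fin (constrCard (Bj ν.M₁ (Z i) (k i)) (k i)) → lieSU (Fin 2)) → ℝ)
        (Lf : (PBond (F.P Kt) 0 → lieSU (Fin 2)) →L[ℝ] (Fin (constrCard (Bj ν.M₁ (Z i) (k i)) (k i)) → lieSU (Fin 2)))
        (Rf : (Fin (constrCard (Bj ν.M₁ (Z i) (k i)) (k i)) → lieSU (Fin 2)) → PBond (F.P Kt) 0 → lieSU (Fin 2)),
        HasFDerivAt (fun Y => fderiv ℝ (msChart F 2 Kt (k i) (Bj ν.M₁ (Z i) (k i)) (avgFamily (Node00.avOfRecord F 2 Kt) (qsstarGIter0 (k i) (ext' Vk))) U₀) Y) Ψ₂ 0 ∧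
        (∀ᶠ Y in 𝓝 (0 : PBond (F.P Kt) 0 → lieSU (Fin 2)),
          DifferentiableAt ℝ (msChart F 2 Kt (k i) (Bj ν.M₁ (Z i) (k i)) (avgFamily (Node00.avOfRecord F 2 Kt) (qsstarGIter0 (k i) (ext' Vk))) U₀) Y) ∧
        fderiv ℝ (fun Y : PBond (F.P Kt) 0 → lieSU (Fin 2) => wilsonAction4 (expChart U₀ Y)) 0 =
          lam.comp (fderiv ℝ (msChart F 2 Kt (k i) (Bj ν.M₁ (Z i) (k i)) (avgFamily (Node00.avOfRecord F 2 Kt) (qsstarGIter0 (k i) (ext' Vk))) U₀) 0) ∧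
        (∀ Y : PBond (F.P Kt) 0 → lieSU (Fin 2), ∑ b, ‖(Y b : Matrix (Fin 2) (Fin 2) ℂ)‖ ^ 2 ≤ p Y ^ 2) ∧
        (∀ v, Lf (Rf v) = v) ∧ (∀ v, p (Rf v) ≤ Cρ i * q v) ∧
        ∀ X : GaugeSlice (pts (k i) (Λ i)) (T i) E3,
          q (fderiv ℝ (msChart F 2 Kt (k i) (Bj ν.M₁ (Z i) (k i)) (avgFamily (Node00.avOfRecord F 2 Kt) (qsstarGIter0 (k i) (ext' Vk))) U₀) 0 (fderiv ℝ Xf 0 X)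
              - Lf (fderiv ℝ Xf 0 X)) ≤ (C₂ i * max δ' δi') * p (fderiv ℝ Xf 0 X) ∧
          lam (Ψ₂ (fderiv ℝ Xf 0 X) (fderiv ℝ Xf 0 X)) ≤ (Cμ i * max δ' δi') * p (fderiv ℝ Xf 0 X) ^ 2 ∧
          p (fderiv ℝ Xf 0 X) ≤ (12 * A' / R' * Real.sqrt (Nat.card {b : PBond (F.P Kt) 0 // b.src ∈ maxDomT ν.M₁ (Z i) 1})) * ‖X‖ ∧
          ∃ m : ℝ, (∀ w', Lf w' = fderiv ℝ (msChart F 2 Kt (k i) (Bj ν.M₁ (Z i) (k i)) (avgFamily (Node00.avOfRecord F 2 Kt) (qsstarGIter0 (k i) (ext' Vk))) U₀) 0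
                (fderiv ℝ Xf 0 X) →
              m ≤ fderiv ℝ (fun Y => fderiv ℝ (fun Y : PBond (F.P Kt) 0 → lieSU (Fin 2) => wilsonAction4 (expChart (1 : GaugeField (F.P Kt) 0 SU2) Y)) Y) 0 w' w') ∧
            (((F.P Kt).L : ℝ) ^ (F.P Kt).d) ^ (k i) / ((((F.P Kt).L : ℝ)) ^ 2 * ((F.P Kt).L : ℝ) ^ 2) ^ (k i) *
                (∑ z ∈ box (fun κ => (hi i κ - lo i κ + 1).toNat + 3) (fun κ => lo i κ - 2), ∑ μ : Fin (F.P Kt).d, ∑ a : Fin 3,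
                  curl (fun b => ιA (pts (k i) (Λ i)) (T i) X (⟨castSite b.1, b.2⟩ : PBond (F.P Kt) (k i)) a) z ⟨0, h0⟩ μ ^ 2)
              - ((((F.P Kt).L : ℝ) ^ (F.P Kt).d) ^ (k i) / ((((F.P Kt).L : ℝ)) ^ 2 * ((F.P Kt).L : ℝ) ^ 2) ^ (k i)
                  * (16 * (((F.P Kt).d : ℝ) + 1) * (Cτ i * max δ' δi'))) * ‖X‖ ^ 2 ≤ m)
    (hfar : ∀ i (b : PBond (F.P Kt) 0), b.src ∉ maxDomT ν.M₁ (Z i) 1 →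
      (⟨blockIter (k i) b.src, b.dir⟩ : PBond (F.P Kt) (k i)) ∉ bondsOf (pts (k i) (Λ i)))
    (hZblk : ∀ i, IsBlockUnion (k i) (Z i))
    (hM2 : 2 ≤ ν.M₁) (hdiv : ∀ i, side (F.P Kt).L ν.M₁ (k i) ∣ (F.P Kt).sitesPerDir 0)
    {B₃ a₀ a₁' : ℝ} (hB₃ : 0 ≤ B₃) (ha₁' : 0 < a₁') (hεreg : 0 < ν.εreg) (ha₀ : ν.εreg ≤ a₀)
    (h15T : ∀ (k' : ℕ), k' ≤ (F.P Kt).m + (F.P Kt).K → side (F.P Kt).L ν.M₁ k' ∣ (F.P Kt).sitesPerDir 0 →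
      ∀ (s : B14.Eq218Concrete.Seq (fun n : ℕ => Node00.unionsOfCubes (F.P Kt) (side (F.P Kt).L ν.M₁ n)) k'),
      Node00.Sect2.SeqSeparated ν.M₁ s → 0 < ν.M₁ →
      ∀ (ε₀ : ℝ) (δ : ℕ → ℝ), (∀ j, j ≤ k' → 0 < δ j ∧ δ j ≤ a₁' ∧ B₃ * δ j ≤ ε₀) → (∀ j, j < k' → δ j ≤ 2 * δ (j + 1)) →
      (∀ j, j < k' → δ (j + 1) ≤ 2 * δ j) → ε₀ ≤ a₀ →
      ∀ W : MSField (F.P Kt) SU2,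
        Node00.Sect2.DataSmall7PTop (Node00.avOfRecord F 2 Kt) s.Ω (Node00.suppDomOfRecord F ν Kt s.Ω) k' δ W →
        ∀ U₀ : GaugeField (F.P Kt) 0 SU2, IsMinimizer (Node00.avOfRecord F 2 Kt)
            {U | (∀ j, j ≤ k' → PlaqSmallOn (Node00.Sect2.omegaPlaqsTop s.Ω (Node00.suppDomOfRecord F ν Kt s.Ω) j)
                (ε₀ * (F.P Kt).eta j ^ 2) U) ∧
              Node00.Sect2.CoDivClassOnTop s.Ω (Node00.suppDomOfRecord F ν Kt s.Ω) k' ε₀ U}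
            (genSet s.Ω k') W U₀ →
          (∀ j, j ≤ k' → PlaqSmallOn (Node00.Sect2.omegaPlaqsTop s.Ω (Node00.suppDomOfRecord F ν Kt s.Ω) j)
              (B₃ * δ j * (F.P Kt).eta j ^ 2) U₀) ∧
            ∀ j, j ≤ k' → Node00.Sect2.CoDivSmallOn (Node00.Sect2.omegaBondsTop s.Ω (Node00.suppDomOfRecord F ν Kt s.Ω) j)
              (B₃ * δ j * (F.P Kt).eta j ^ 3) U₀)
    : ∃ a₁ : ι → ℝ, (∀ i, 0 < a₁ i) ∧
      B15.Prop1Printed (lfVarOn su2Chart fun i =>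
        InstOn.std (Node00.bgMSCoPOfRecord F 2 ν Kt (k i) (maxDomT ν.M₁ (Z i))) ν.M₁ (Z i) (Λ i) (k i) (M i) (a₁ i)
          (anExt (pts (k i) (Λ i)) (T i)
            (fun177std (Node00.bgMSCoPOfRecord F 2 ν Kt (k i) (maxDomT ν.M₁ (Z i))) ν.M₁ (Z i) (k i)) (ext i)
            (min (1 / 2) (min (R i / 8) ((12 * ((F.P Kt).d : ℝ)) ^ 2 / (10 * bx ^ 2) / (M i) ^ 5 * (R i / 2) ^ 2 /
              (48 * (4 * ((Fintype.card (Plaq (F.P Kt) 0) : ℝ) * (1 + 8 * 𝓐₀ i ^ 4)) / R i + 1)))))))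
    := by
  have hd1 : 1 ≤ (F.P Kt).d := h0
  -- (3) the smallness thresholds `δ₀ i` of the numerics letter `hsm` at Schur size `K i := n i + 1` and `Kc i := 12𝓐₀ i∕R i·√N₁` — chosen BEFORE the guard
  obtain ⟨δ₀, hδ₀, _hδ₀1, hsmOf⟩ := exists_delta_hsm_chartConstants_family hd1 (fun i => n i + 1) (fun i => Nat.succ_pos (n i))
    (fun i => 12 * 𝓐₀ i / R i * Real.sqrt (Nat.card {b : PBond (F.P Kt) 0 // b.src ∈ maxDomT ν.M₁ (Z i) 1})) Cμ Cτ hCρ hC₂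
  -- the TARGET tolerance handed to the gauge letter: below the threshold and below the chart letter's smallness radius
  obtain ⟨δs, hδs0, hδsδ₀, hδsρ⟩ : ∃ δs : ι → ℝ, (∀ i, 0 < δs i) ∧ (∀ i, δs i ≤ δ₀ i) ∧ ∀ i, δs i ≤ ρs i :=
    ⟨fun i => min (δ₀ i) (ρs i), fun i => lt_min (hδ₀ i) (hρs i), fun i => min_le_left _ _, fun i => min_le_right _ _⟩
  -- (4) the gauge letter at the target tolerance: one guard `e i` per instance
  choose e he hσe using fun i => hσN i (δs i) (hδs0 i)
  -- the bookkeeping constant `cE` of the finite family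
  obtain ⟨cE', hcE'⟩ := Finite.exists_le (fun i => 12 * ((F.P Kt).d : ℝ) * ((n i : ℝ) + 2) ^ 2)
  have hcE0 : (0 : ℝ) ≤ max cE' 0 := le_max_right _ _
  have hcE : ∀ i, 12 * ((F.P Kt).d : ℝ) * ((n i : ℝ) + 2) ^ 2 ≤ max cE' 0 := fun i => (hcE' i).trans (le_max_left _ _)
  have hcE1 : (0 : ℝ) < max cE' 0 + 1 := by linarith
  have hB1 : (0 : ℝ) < (B₃ + 1) * (max cE' 0 + 1) := mul_pos (by linarith) hcE1
  -- THE GUARD: below the reference guard, the gauge letter's guard and the two bookkeeping caps of the [15] door (`heRa`)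
  obtain ⟨eR, heR, heR₀', heRe, heRa⟩ : ∃ eR : ι → ℝ, (∀ i, 0 < eR i) ∧ (∀ i, eR i ≤ eR₀ i) ∧ (∀ i, eR i ≤ e i) ∧
      ∀ i, (max cE' 0 + 1) * eR i ≤ a₁' ∧ B₃ * ((max cE' 0 + 1) * eR i) ≤ ν.εreg := by
    refine ⟨fun i => min (eR₀ i) (min (e i) (min (a₁' / (max cE' 0 + 1)) (ν.εreg / ((B₃ + 1) * (max cE' 0 + 1))))),
      fun i => lt_min (heR₀ i) (lt_min (he i) (lt_min (div_pos ha₁' hcE1) (div_pos hεreg hB1))), fun i => min_le_left _ _,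
      fun i => (min_le_right _ _).trans (min_le_left _ _), fun i => ?_⟩
    beta_reduce
    have hpos : 0 < min (eR₀ i) (min (e i) (min (a₁' / (max cE' 0 + 1)) (ν.εreg / ((B₃ + 1) * (max cE' 0 + 1))))) :=
      lt_min (heR₀ i) (lt_min (he i) (lt_min (div_pos ha₁' hcE1) (div_pos hεreg hB1)))
    have h1 : min (eR₀ i) (min (e i) (min (a₁' / (max cE' 0 + 1)) (ν.εreg / ((B₃ + 1) * (max cE' 0 + 1))))) ≤ a₁' / (max cE' 0 + 1) :=
      (min_le_right _ _).trans ((min_le_right _ _).trans (min_le_left _ _))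
    have h2 : min (eR₀ i) (min (e i) (min (a₁' / (max cE' 0 + 1)) (ν.εreg / ((B₃ + 1) * (max cE' 0 + 1))))) ≤ ν.εreg / ((B₃ + 1) * (max cE' 0 + 1)) :=
      (min_le_right _ _).trans ((min_le_right _ _).trans (min_le_right _ _))
    rw [le_div_iff₀ hcE1] at h1
    rw [le_div_iff₀ hB1] at h2
    have h3 : 0 ≤ min (eR₀ i) (min (e i) (min (a₁' / (max cE' 0 + 1)) (ν.εreg / ((B₃ + 1) * (max cE' 0 + 1))))) * (max cE' 0 + 1) :=
      mul_nonneg hpos.le hcE1.le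
    constructor
    · linarith
    · nlinarith [hB₃, h3]
  -- the datum tolerances are linear in the guard, hence monotone
  have hρlin : ∀ i (t t' : ℝ), t ≤ t' → (((F.P Kt).d : ℝ) * n' i + 1) * ((((F.P Kt).d - 1 : ℕ) : ℝ) * n' i * ((12 * (F.P Kt).d * (n i + 2) ^ 2 + 1) * t) + 3 * (F.P Kt).d * (n i + 2) ^ 2 * t) ≤ (((F.P Kt).d : ℝ) * n' i + 1) * ((((F.P Kt).d - 1 : ℕ) : ℝ) * n' i * ((12 * (F.P Kt).d * (n i + 2) ^ 2 + 1) * t') + 3 * (F.P Kt).d * (n i + 2) ^ 2 * t') := by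
    intro i t t' h
    have key : ∀ s : ℝ, (((F.P Kt).d : ℝ) * n' i + 1) * ((((F.P Kt).d - 1 : ℕ) : ℝ) * n' i * ((12 * (F.P Kt).d * (n i + 2) ^ 2 + 1) * s) + 3 * (F.P Kt).d * (n i + 2) ^ 2 * s)
        = ((((F.P Kt).d : ℝ) * n' i + 1) * ((((F.P Kt).d - 1 : ℕ) : ℝ) * n' i * (12 * (F.P Kt).d * (n i + 2) ^ 2 + 1) + 3 * (F.P Kt).d * (n i + 2) ^ 2)) * s :=
      fun s => by ring
    rw [key, key]
    exact mul_le_mul_of_nonneg_left h (by positivity)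
  -- the bookkeeping constant `cJ` of the finite family (`cA` is its defining expression)
  obtain ⟨cJ', hcJ'⟩ := Finite.exists_le (fun i => 2 * (1 / 2 * (B₃ * (max cE' 0 + 1) * (F.P Kt).eta 1 ^ 2) ^ 2 * (Fintype.card (Plaq (F.P Kt) 0) : ℝ)) * eR i / R i
      + 4 * ((Fintype.card (Plaq (F.P Kt) 0) : ℝ) * (1 + 8 * 𝓐₀ i ^ 4)) / (R i * eR i))
  -- (5) `γ := (12d)²∕(10bx²)`, `K i := n i + 1`, and (iii) at all of the above
  refine N12Prop1OfGaugeLetterAndChartConstantsLoc.exists_domain_prop1Printed_lfVarOn_std_su2_box_intrinsic_analytic_atZSeqCoPRecord_ofThm1TorusClass_ofMinimiserFamily_ofGaugeLetterN_ofChartConstantsN_ofCoercive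
    ν Kt hd3 h0 Z Λ k M hk0 hk eR heR T lo hi n hn hN hbox hZ hTG0 hN5 (fun i => n i + 1) (fun i => Nat.succ_pos (n i))
    (fun i κ => toNat_side_le_succ (hn i) κ) ext hext hlohi LO HI hLO hHI n' hn' hn'N hR'
    (fun i => (((F.P Kt).d : ℝ) * n' i + 1) * ((((F.P Kt).d - 1 : ℕ) : ℝ) * n' i * ((12 * (F.P Kt).d * (n i + 2) ^ 2 + 1) * eR i) + 3 * (F.P Kt).d * (n i + 2) ^ 2 * eR i)) (fun i => le_rfl)
    (γ := (12 * ((F.P Kt).d : ℝ)) ^ 2 / (10 * bx ^ 2)) (cJ := max cJ' 0) (gamma_one_pos hd1 hbx) (le_max_right _ _) hbx.le hbxM hM hR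
    (fun i Vk hV => hMin i Vk (plaqSmallOn_of_le (heR₀' i) hV))
    (δc := δs) (δin := δs) (fun i => (hδs0 i).le) (fun i => (hδs0 i).le) ρs Cμ Cρ C₂ Cτ hCμ hCρ hC₂
    (fun i => ⟨by rw [max_self]; exact hδs0 i, by rw [max_self]; exact hδsρ i⟩) h𝓐₀ N
    (fun i Vk hV hnV U₀ hU₀ => hσe i Vk (plaqSmallOn_of_le (heRe i) hV) (fun b hb => (hnV b hb).trans (hρlin i _ _ (heRe i))) U₀ hU₀)
    hchartN (fun i => hsmOf i (δs i) (δs i) (hδs0 i).le (by rw [max_self]; exact hδsδ₀ i))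
    (hγle_family_one hbx n M hM hbxM) hfar hZblk hM2 hdiv (cE := max cE' 0)
    (cA := 1 / 2 * (B₃ * (max cE' 0 + 1) * (F.P Kt).eta 1 ^ 2) ^ 2 * (Fintype.card (Plaq (F.P Kt) 0) : ℝ))
    hcE0 hcE hB₃ heRa ha₀ le_rfl h15T (fun i => (hcJ' i).trans (le_max_left _ _))

end Summit.QuantumFields.YangMills.BalabanUVNodes.N12Prop1AssembledOfGaugeLetterAtToleranceLoc

end
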